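import Literature.MathematicalPhysics.QuantumLattice.BalabanRG

/-!
# `Balaban1983to89.B8ConstraintBonds` — B8 = T. Bałaban, *Spaces of regular gauge field
# configurations on a lattice and gauge fixing conditions*, Commun. Math. Phys. **99**, 75–102
# (1985): the CONSTRAINT-BOND SET of (1.13)/(1.29)/(1.31) and the invariance sentence of p. 78 —
# kernel certificate for the located gap GAPS `G-adv8-10` of the audit cell `pub-balaban`

CITATION HEADER (lean-in-tree rule 2026-08-18).  Bib key `Balaban1985RegularSpaces`; held PDF
`paper:balaban1985-cmp99-regular-spaces-gauge-fixing` (journal page = PDF page + 74); renders read as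
images for this module by unit b2b-balaban-b08-g6 (pub-balaban PAPER SUB-CELL B08 gen 6, 2026-08-18):
`…/1985-cmp99-regular-spaces-gauge-fixing-p003-x2.png` (p. 77: (1.3)–(1.6) and the bond convention),
`p004-x2` (p. 78: (1.12)–(1.14)), `p007-x2` (p. 81: (1.28)–(1.29)), `p008-x2` (p. 82: (1.30)–(1.31)).
The paper is a manuscript UNDER ADJUDICATION; nothing of it is asserted here.  The one analytic
input of the disputed sentence — the covariance law of the averages under gauge transformations,
p. 78 l. 5 — enters as the named HYPOTHESIS `CovLaw` and is moreover DISCHARGED (theorem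
`covLaw_axialBlockHolonomy`) for the tree's computable average `QuantumLattice.axialBlockHolonomy`
(prelude A18 `BalabanRG`, proved there from telescoping: `axialBlockHolonomy_gaugeTransformZd`).
The geometric setting (1.3)–(1.4) enters as the hypothesis structure `DomainSeq`.  SIBLING of the landed
`…Balaban1983to89.B8` (reader r1 / sub-cell b08: the typed statements of B8), which is NOT modified and
not imported (nothing there concerns the bond sets); the `ℤ^d` vocabulary `Site`, `ZdEdge`, `LGConfig`,
`gaugeTransformZd` (`QuantumLattice.LatticeGaugeDLR`) and `blockMap`, `blockBase`, `blockBase_add_single`,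
`blockMap_blockBase_add_of_lt`, `axialBlockHolonomy` (`QuantumLattice.BalabanRG`) is used by name.

WHAT IS PRINTED (verbatim).  p. 77 [PDF 3]: *"We consider a sequence of domains (see also [2.II, 4])
Ω₀ ⊃ Ω₁ ⊃ Ω₂ ⊃ … ⊃ Ω_k, Ω_j ⊂ T_η, j = 0, 1, …, k, (1.3) which satisfy the following conditions:
Ω_j = B^j(Ω_j^{(j)}), Ω_j is a sum of cubes of a size M₁L^jη, (L^jη)^{-1} dist(Ω_j^c, Ω_{j+1}) > RM₁. (1.4)
… The sets Ω_j are identified with sets of bonds, or sets of plaquettes, in the following way. If Ω ⊂ T_η,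
then we denote by Ω also the set of bonds ⋃_{x∈Ω} st(x) = {bonds b ⊂ T_η : at least one end-point of b
belongs to Ω}. Similarly for the corresponding set of plaquettes. This convention applies to an arbitrary
lattice. Let us denote Λ_j = Ω_j^{(j)} ∖ Ω_{j+1}^{(j)}, j = 0, 1, …, k − 1, Λ_k = Ω_k^{(k)}, (1.5) …
Let us notice that we admit the case where some domains Ω_j are equal to T_η, for example Ω_j = T_η for
j = 0, 1, …, l, l ≦ k."*  p. 78 [PDF 4]: *"We denote 𝔅_k = ⋃_{j=0}^{k} Λ_j (1.12) (the same for the sets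
of bonds), and for an arbitrary configuration V on 𝔅_k we define 𝔅_k(𝔅_k, V) is a set of all gauge
field configurations U satisfying the conditions Ū^j = V on Λ_j, j = 0, …, k. (1.13)  Because
(Ū^{u j})_b = (Ū^j)^u_b = u(b₋)(Ū^j)_b u^{-1}(b₊) for b ⊂ T^{(j)}, hence the set 𝔅_k(𝔅_k, V) is invariant
with respect to gauge transformations u satisfying the conditions u(y) = 1 for y ∈ 𝔅_k. (1.14)  They form
a subgroup of the group of all gauge transformations and we are interested in spaces of orbits of this
subgroup."*  p. 81 [PDF 7], the two sentences after (1.30): *"If both end-points b₋, b₊ of a bond b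
belong to Λ_j, then the expression on the left-hand side of (1.30) is equal to (Ū₁^j)_b by (92) of [3].
If a bond b crosses the boundary of Λ_j, then one of the end-points belongs to Λ_j, e.g. b₊ ∈ Λ_j, and
another to Λ_{j−1}, b₋ ∈ Λ_{j−1}."*  p. 82 [PDF 8], the two case labels of the display (1.31):
*"(Ū₁^j)_b = V′_b = exp iB_b, if b ⊂ Λ_j (i.e., b₋, b₊ ∈ Λ_j),"* and *"= exp iB_b, if b₋ ∈ Λ_{j−1}, b₊ ∈ Λ_j,
(1.31)"*.  (REVISION v1.1, unit b2b-balaban-b08-g7, 2026-08-18, DOCSTRING-ONLY — every declaration of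
revision v1 = p179223 is byte-identical: the former third item of this paragraph, «p. 82 [PDF 8], before
(1.31): "… there are possible two cases: either b₋, b₊ ∈ Λ_j, or they belong to different sets, e.g. …"»,
was a PARAPHRASE placed inside quotation marks with a wrong locator — cross-read GAPS `C-pv25g3-12`,
violation V1; it is replaced by the two verbatim loci above, read as images on the renders `p007-x2` /
`p008-x2` by b08-g7.  The mathematical point it served — the printed case list names ONE orientation of a
boundary bond, with an "e.g." — is carried by exactly these loci, so `exists_classII_printed` /
`exists_classII_mirrored` and GAPS `G-adv8-10 (b)` are unaffected.  Same revision: the glyph «l ≦ k» of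
p. 77 restored (advisory A1); the B12 pointer in WHAT IS NOT CLAIMED made verbatim (A2); the secondary
pointer of the `CovLaw` docstring corrected from "B7 (88)" to B7's covariance demand (11), p. 19 (A4).)

THE LOCATED GAP (GAPS `G-adv8-10`, adversarial reader adv8-g9).  Read with the p. 77 convention, "Ū^j = V
on Λ_j" constrains every level-`j` bond with AT LEAST ONE endpoint in `Λ_j`.  Among these are INNER
boundary bonds whose other endpoint lies in `Ω_{j+1}` and is not a point of `𝔅_k`; there (1.14) leaves
`u` free, and by the displayed covariance law the constraint is NOT preserved.  Proposed repair R_A: the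
constraint bonds of level `j` are the level-`j` bonds with at least one endpoint in `Λ_j` and NO endpoint
in `Ω_{j+1}`.

MODEL (scaled coordinates, as in `B7BlockGeometry`).  The fine lattice `ηℤ^d` is `Fin d → ℤ`
(`= LatticeModels.Site d`, written out because the enclosing `QuantumFieldTheory` namespace has its own
torus `Site`; unit `η`; the torus `T_η` is replaced by `ℤ^d`, `Ω_0 = T_η` becoming `Ω 0 = Set.univ`);
the level-`j` lattice
`L^jηℤ^d` is the set of `IsLevel L j` points (all coordinates divisible by `L^j`); a positively oriented
level-`j` bond is labelled by a coarse edge `c = (y, i) : ZdEdge d` and has endpoints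
`src L j c = L^j y` (`= blockBase (L^j) y`) and `tgt L j c = L^j y + L^j e_i`; the domains are a sequence
`Ω : ℕ → Set (Fin d → ℤ)` (with `Ω n = ∅` for `n > k`, so that `Lam L Ω k = Ω_k^{(k)}` as in (1.5));
`Lam L Ω j` is (1.5) and `Bk L Ω` is (1.12) as POINT sets.  The averages `Ū^j` are an arbitrary family
`avg : ℕ → LGConfig d G → LGConfig d G` (level `j`, fine configuration ↦ values on level-`j` bonds);
`Constr bonds avg V` is (1.13) with the constraint imposed on the bond family `bonds : ℕ → Set (ZdEdge d)`;
`ResGauge B` is the subgroup (1.14); `literalBonds` is the p. 77 reading of "on Λ_j", `bondsA` the repair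
R_A of `G-adv8-10`, `bondsB` the weaker repair "at least one endpoint in Λ_j and both endpoints in 𝔅_k".

WHAT IS PROVED (0 `sorry`; [folklore] = finite bookkeeping on `ℤ^d` and one-line group algebra):
* `invariant_of_endpoints_mem`: under `CovLaw`, (1.13) IS invariant under (1.14) as soon as every
  constraint bond has both endpoints in the set where `u = 1` — whence `bondsB_invariant` (unconditionally)
  and `bondsA_invariant` (for a `DomainSeq` with `Ω 0 = univ`, via `bondsA_subset_bondsB`): p. 78's sentence
  holds under either repair;
* `exists_resGauge_not_mem`: under `CovLaw`, a constraint bond with an endpoint outside that set and a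
  group element `a ≠ 1` give, for EVERY constrained `U`, a `u ≡ 1` on the set moving `U` out of (1.13);
* `literal_bad_bond`, `literal_not_invariant`, `literal_not_Invariant`: for every `DomainSeq` with `2 ≤ L`
  and every `j` with `Ω (j+1)` finite and nonempty, the LITERAL reading has a constraint bond of level `j`
  whose source lies in `Ω_{j+1}` but not in `𝔅_k` (the last level-`j` point below an upper face of
  `Ω_{j+1}`: its `i`-th coordinate is `≡ −L^j (mod L^{j+1})`, so it is not a level-`(j+1)` point), in EVERY
  dimension `d ≥ 1`; hence (1.13)-literal is not invariant under (1.14) for any nontrivial `G` — this is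
  `G-adv8-10 (a)`, sharpened from "d ≥ 2" (lower faces) to all `d`;
* `outer_bondA`, `bondsA_not_invariant_outer`: if `Ω_0 ≠ T_η` has an exiting bond, repair R_A still
  constrains a level-`0` bond leaving `Ω_0`, whose outer endpoint is not in `𝔅_k` — so R_A restores the
  invariance for `Ω_0 = T_η` (`bondsA_invariant`) but not for a proper `Ω_0` with `u` free outside `Ω_0`,
  while R_B restores it unconditionally;
* `lowerFace_bond`, `exists_lowerFace`: R_B ∖ R_A is nonempty whenever some `Ω (j+1)` is finite nonempty
  (level-`j` bonds from `Λ_j` INTO the level-`(j+1)` points on lower faces of `Ω_{j+1}`, which lie in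
  `Λ_{j+1} ⊂ 𝔅_k`) — the residual ambiguity "R_A or R_B" is recorded, not resolved, in `G-adv8-10`;
* `exists_classII_printed`, `exists_classII_mirrored`: boundary bonds between `Λ_{j−1}` and `Λ_j` occur in
  BOTH orientations (`b₋ ∈ Λ_{j−1}, b₊ ∈ Λ_j` as printed on p. 81 after (1.30) and in the second case
  label of (1.31), and `b₋ ∈ Λ_j, b₊ ∈ Λ_{j−1}`) for
  every `j ≥ 1` with `Ω_j` finite nonempty — `G-adv8-10 (b)`: the case list "e.g." of (1.31) is not
  exhaustive;
* `covLaw_axialBlockHolonomy`: the hypothesis `CovLaw` holds for the axial block holonomy, and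
  `cubeSeq_domainSeq`, `cube_axial_not_Invariant`: the fully concrete instance `Ω_0 = ℤ^d`,
  `Ω_1 = [0, Lm)^d`, `Ω_n = ∅ (n ≥ 2)`, `L ≥ 2`, `m ≥ 1`, `d ≥ 1`, any group with an element `≠ 1`.

WHAT IS NOT CLAIMED.  Nothing about Bałaban's nonlinear averages beyond the displayed covariance law
(taken as hypothesis); nothing about which repair (R_A, R_B, or another) the later papers use (B12,
CMP **109** (1987) p. 276 [PDF 28], after (3.30), render `1987-cmp109-rg-I-small-field-p028-x2` read as an
image: *"The function B above is defined on the set of bonds determining U_j(□₀), i.e. on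
(⋃_{n=0}^{j−1} Λ_n) ∪ □_j^{(j)}."* — see GAPS `G-B11-G5`); the metric
condition of (1.4) is used only through its consequence `DomainSeq.sep` (the `ℓ^∞`-ball of radius
`L^{n+1}η` about `Ω_{n+1}` lies in `Ω_n`, i.e. `RM₁ ≥ L` for the `ℓ^∞` distance, `RM₁ ≥ √d·L` for the
Euclidean one — the paper does not say which `dist` is meant), and "Ω_j is a sum of cubes of a size
M₁L^jη" only through `DomainSeq.sat` (`Ω_j = B^j(Ω_j^{(j)})`).  Value = kernel certificate of a located gap of the
audit, NOT summit progress.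
-/

open Literature.Probability.LatticeModels
open Literature.MathematicalPhysics.QuantumLattice

namespace Literature.MathematicalPhysics.QuantumFieldTheory.Balaban1983to89.B8ConstraintBonds

variable {d : ℕ}

/-! ### Levels and steps (scaled coordinates: the fine spacing `η` is the unit) -/

/-- `x ∈ ηℤ^d` is a point of the level-`j` lattice `L^jηℤ^d`: every coordinate is divisible by `L^j`
(B8 p. 77 [PDF 3], the lattices `T^{(j)}`; scaled coordinates). [folklore] -/
def IsLevel (L j : ℕ) (x : (Fin d → ℤ)) : Prop := ∀ i, (L : ℤ) ^ j ∣ x i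

/-- The level-`j` step `L^jη e_i` in direction `i` (the displacement along a level-`j` bond). [folklore] -/
def step (L j : ℕ) (i : Fin d) : (Fin d → ℤ) := Pi.single i ((L : ℤ) ^ j)

/-- The `i`-th coordinate of the step `L^j e_i` is `L^j`. [folklore] -/
@[simp] theorem step_apply_same (L j : ℕ) (i : Fin d) : step L j i i = (L : ℤ) ^ j :=
  Pi.single_eq_same _ _

/-- The other coordinates of the step `L^j e_i` vanish. [folklore] -/
theorem step_apply_ne (L j : ℕ) {i i' : Fin d} (h : i' ≠ i) : step L j i i' = 0 :=
  Pi.single_eq_of_ne h _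

/-- `|(L^j e_i)_{i'}| ≤ L^n` for `j ≤ n`, `L ≥ 1`. [folklore] -/
theorem abs_step_le {L : ℕ} (hL : 1 ≤ L) {j n : ℕ} (hjn : j ≤ n) (i i' : Fin d) :
    |step L j i i'| ≤ (L : ℤ) ^ n := by
  by_cases h : i' = i
  · subst h
    rw [step_apply_same, abs_of_nonneg (pow_nonneg (by positivity) _)]
    exact pow_le_pow_right₀ (by exact_mod_cast hL) hjn
  · rw [step_apply_ne L j h, abs_zero]; positivity

namespace IsLevel

/-- A level-`n` point is a level-`j` point for `j ≤ n`. [folklore] -/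
theorem mono {L j n : ℕ} {x : (Fin d → ℤ)} (h : IsLevel L n x) (hjn : j ≤ n) : IsLevel L j x :=
  fun i => (pow_dvd_pow (L : ℤ) hjn).trans (h i)

/-- Level `0` is the whole fine lattice. [folklore] -/
theorem zero (L : ℕ) (x : (Fin d → ℤ)) : IsLevel L 0 x := fun i => by simp

/-- The level-`j` lattice is closed under level-`j` steps. [folklore] -/
theorem add_step {L j : ℕ} {x : (Fin d → ℤ)} (h : IsLevel L j x) (i : Fin d) :
    IsLevel L j (x + step L j i) := by
  intro i'
  rw [Pi.add_apply]
  by_cases hi : i' = i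
  · subst hi; rw [step_apply_same]; exact dvd_add (h i') dvd_rfl
  · rw [step_apply_ne L j hi, add_zero]; exact h i'

/-- The level-`j` lattice is closed under backward level-`j` steps. [folklore] -/
theorem sub_step {L j : ℕ} {x : (Fin d → ℤ)} (h : IsLevel L j x) (i : Fin d) :
    IsLevel L j (x - step L j i) := by
  intro i'
  rw [Pi.sub_apply]
  by_cases hi : i' = i
  · subst hi; rw [step_apply_same]; exact dvd_sub (h i') dvd_rfl
  · rw [step_apply_ne L j hi, sub_zero]; exact h i'

end IsLevel

/-- Block corners `L^j y` are level-`j` points. [folklore] -/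
theorem isLevel_blockBase (L j : ℕ) (y : (Fin d → ℤ)) : IsLevel L j (blockBase (L ^ j) y) := fun i => by
  simp only [blockBase, Nat.cast_pow]; exact dvd_mul_right _ _

/-- On level-`j` points `blockBase (L^j) ∘ blockMap (L^j)` is the identity. [folklore] -/
theorem blockBase_blockMap_of_isLevel {L j : ℕ} {x : (Fin d → ℤ)} (h : IsLevel L j x) :
    blockBase (L ^ j) (blockMap (L ^ j) x) = x := by
  funext i
  simp only [blockBase, blockMap, Nat.cast_pow]
  exact Int.mul_ediv_cancel' (h i)

/-- KEY ARITHMETIC FACT behind `G-adv8-10 (a)` in every dimension: for `L ≥ 2`, a level-`(j+1)` point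
`x` and `x + L^j e_i` lie in the SAME level-`(j+1)` block (`0 ≤ L^j < L^{j+1}`).  Contrapositively, the
last level-`j` point below an upper face of a union of level-`(j+1)` blocks is never a level-`(j+1)`
point. [folklore] -/
theorem blockMap_add_step_of_isLevel_succ {L : ℕ} (hL : 2 ≤ L) {j : ℕ} {x : (Fin d → ℤ)}
    (hx : IsLevel L (j + 1) x) (i : Fin d) :
    blockMap (L ^ (j + 1)) (x + step L j i) = blockMap (L ^ (j + 1)) x := by
  have h1 : 1 < L := hL
  haveI : NeZero (L ^ (j + 1)) := ⟨(pow_pos (by omega) _).ne'⟩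
  conv_lhs => rw [← blockBase_blockMap_of_isLevel hx]
  refine blockMap_blockBase_add_of_lt _ _ _ (fun i' => ?_) (fun i' => ?_)
  · by_cases h : i' = i
    · subst h; rw [step_apply_same]; positivity
    · rw [step_apply_ne L j h]
  · push_cast
    by_cases h : i' = i
    · subst h; rw [step_apply_same]
      exact pow_lt_pow_right₀ (by exact_mod_cast h1) (Nat.lt_succ_self j)
    · rw [step_apply_ne L j h]; positivity

/-! ### The sets `Λ_j` (1.5) and `𝔅_k` (1.12), as point sets -/

/-- `Λ_j = Ω_j^{(j)} ∖ Ω_{j+1}^{(j)}` (B8 (1.5), p. 77 [PDF 3]): the level-`j` points of `Ω_j` not in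
`Ω_{j+1}`; with `Ω (k+1) = ∅` this gives `Λ_k = Ω_k^{(k)}`. [cite: Balaban1985RegularSpaces, (1.5)] -/
def Lam (L : ℕ) (Ω : ℕ → Set (Fin d → ℤ)) (j : ℕ) : Set (Fin d → ℤ) :=
  {x | IsLevel L j x ∧ x ∈ Ω j ∧ x ∉ Ω (j + 1)}

/-- `𝔅_k = ⋃_j Λ_j` (B8 (1.12), p. 78 [PDF 4]) as a set of POINTS — the set on which (1.14) demands
`u = 1`. [cite: Balaban1985RegularSpaces, (1.12)] -/
def Bk (L : ℕ) (Ω : ℕ → Set (Fin d → ℤ)) : Set (Fin d → ℤ) := {x | ∃ j, x ∈ Lam L Ω j}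

/-- `Λ_j ⊆ 𝔅_k` (1.12). [folklore] -/
theorem mem_Bk_of_mem_Lam {L : ℕ} {Ω : ℕ → Set (Fin d → ℤ)} {j : ℕ} {x : (Fin d → ℤ)}
    (h : x ∈ Lam L Ω j) : x ∈ Bk L Ω := ⟨j, h⟩

/-! ### Level-`j` bonds and the three candidate constraint-bond sets -/

/-- Source `b₋ = L^j y` of the level-`j` bond labelled by the coarse edge `c = (y, i)`. [folklore] -/
def src (L j : ℕ) (c : ZdEdge d) : (Fin d → ℤ) := blockBase (L ^ j) c.1

/-- Target `b₊ = L^j y + L^j e_i` of the level-`j` bond labelled by `c = (y, i)`. [folklore] -/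
def tgt (L j : ℕ) (c : ZdEdge d) : (Fin d → ℤ) := blockBase (L ^ j) c.1 + step L j c.2

/-- `b₊ = b₋ + L^j e_i`. [folklore] -/
theorem tgt_eq_src_add (L j : ℕ) (c : ZdEdge d) : tgt L j c = src L j c + step L j c.2 := rfl

/-- `b₋ = b₊ − L^j e_i`. [folklore] -/
theorem src_eq_tgt_sub (L j : ℕ) (c : ZdEdge d) : src L j c = tgt L j c - step L j c.2 := by
  rw [tgt_eq_src_add, add_sub_cancel_right]

/-- `b₊` is the corner of the next block: `tgt = blockBase (L^j) (y + e_i)` (so that the covariance law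
of `axialBlockHolonomy` is literally `CovLaw`). [folklore] -/
theorem tgt_eq_blockBase (L j : ℕ) (c : ZdEdge d) :
    tgt L j c = blockBase (L ^ j) (c.1 + Pi.single c.2 1) := by
  rw [blockBase_add_single, mul_one, tgt, step, Nat.cast_pow]

/-- `b₋` is a level-`j` point. [folklore] -/
theorem isLevel_src (L j : ℕ) (c : ZdEdge d) : IsLevel L j (src L j c) := isLevel_blockBase L j c.1

/-- `b₊` is a level-`j` point. [folklore] -/
theorem isLevel_tgt (L j : ℕ) (c : ZdEdge d) : IsLevel L j (tgt L j c) :=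
  (isLevel_src L j c).add_step c.2

/-- A bond has two distinct endpoints (`L ≥ 1`). [folklore] -/
theorem src_ne_tgt {L : ℕ} (hL : 1 ≤ L) (j : ℕ) (c : ZdEdge d) : src L j c ≠ tgt L j c := by
  intro h
  have h1 := congr_fun h c.2
  rw [tgt_eq_src_add, Pi.add_apply, step_apply_same] at h1
  have hp : (0 : ℤ) < (L : ℤ) ^ j := pow_pos (by exact_mod_cast hL) j
  linarith

/-- The level-`j` bond starting at the level-`j` point `x` in direction `i`. [folklore] -/
def bondAt (L j : ℕ) (x : (Fin d → ℤ)) (i : Fin d) : ZdEdge d := (blockMap (L ^ j) x, i)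

/-- The bond at a level-`j` point `x` starts at `x`. [folklore] -/
theorem src_bondAt {L j : ℕ} {x : (Fin d → ℤ)} (h : IsLevel L j x) (i : Fin d) :
    src L j (bondAt L j x i) = x := blockBase_blockMap_of_isLevel h

/-- … and ends at `x + L^j e_i`. [folklore] -/
theorem tgt_bondAt {L j : ℕ} {x : (Fin d → ℤ)} (h : IsLevel L j x) (i : Fin d) :
    tgt L j (bondAt L j x i) = x + step L j i := by
  rw [tgt_eq_src_add, src_bondAt h]; rfl

/-- LITERAL reading of "Ū^j = V on Λ_j" (1.13) with the p. 77 convention *"we denote by Ω also the set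
of bonds … at least one end-point of b belongs to Ω … This convention applies to an arbitrary lattice"*:
the level-`j` bonds with at least one endpoint in `Λ_j`. [cite: Balaban1985RegularSpaces, p. 77 and (1.13)] -/
def literalBonds (L : ℕ) (Ω : ℕ → Set (Fin d → ℤ)) (j : ℕ) : Set (ZdEdge d) :=
  {c | src L j c ∈ Lam L Ω j ∨ tgt L j c ∈ Lam L Ω j}

/-- Repair R_A (GAPS `G-adv8-10`, adv8-g9): at least one endpoint in `Λ_j` and NO endpoint in `Ω_{j+1}`.
An audit-internal proposal, typed here only to be tested — not a statement of the paper and not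
asserted. [folklore] -/
def bondsA (L : ℕ) (Ω : ℕ → Set (Fin d → ℤ)) (j : ℕ) : Set (ZdEdge d) :=
  {c | c ∈ literalBonds L Ω j ∧ src L j c ∉ Ω (j + 1) ∧ tgt L j c ∉ Ω (j + 1)}

/-- Repair R_B: at least one endpoint in `Λ_j` and BOTH endpoints in `𝔅_k` (the largest sub-family of the
literally-read bonds making p. 78's invariance sentence true).  An audit-internal proposal, typed here
only to be tested — not a statement of the paper and not asserted. [folklore] -/
def bondsB (L : ℕ) (Ω : ℕ → Set (Fin d → ℤ)) (j : ℕ) : Set (ZdEdge d) :=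
  {c | c ∈ literalBonds L Ω j ∧ src L j c ∈ Bk L Ω ∧ tgt L j c ∈ Bk L Ω}

/-! ### The gauge side: (1.13), (1.14) and the covariance law of p. 78 l. 5 -/

section Gauge

variable {G : Type*}

/-- The covariance law of the averages under gauge transformations, B8 p. 78 [PDF 4] l. 5:
*"(Ū^{u j})_b = (Ū^j)^u_b = u(b₋)(Ū^j)_b u^{-1}(b₊) for b ⊂ T^{(j)}"* (it is the covariance demand of
[3] = B7, T. Bałaban, CMP **98** (1985) p. 19 [PDF 3], render `1985-cmp98-averaging-p003-x2` read as an
image: *"we demand that the averaging preserves gauge transformations, i.e.,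
(Ū^u‾)(y, y′) = u(y)Ū(y, y′)u^{-1}(y′), or Ū^u‾ = (Ū)^u. (11)"*; revision v1 pointed here to "B7 (88)",
which is the k-th order averaging formula of B7 p. 31, not the covariance law — corrected in revision
v1.1, cross-read advisory A4 of GAPS `C-pv25g3-12`), for an
ABSTRACT family of level-`j` averages `avg j : LGConfig d G → LGConfig d G` (values on level-`j` bonds
labelled by coarse edges).  A HYPOTHESIS of the theorems below; discharged for the axial block holonomy
in `covLaw_axialBlockHolonomy`. [cite: Balaban1985RegularSpaces, p. 78 l. 5] -/
def CovLaw [Group G] (L : ℕ) (avg : ℕ → LGConfig d G → LGConfig d G) : Prop :=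
  ∀ (j : ℕ) (g : (Fin d → ℤ) → G) (U : LGConfig d G) (c : ZdEdge d),
    avg j (gaugeTransformZd g U) c = g (src L j c) * avg j U c * (g (tgt L j c))⁻¹

/-- `𝔅_k(𝔅_k, V)` of (1.13), p. 78 [PDF 4]: *"a set of all gauge field configurations U satisfying the
conditions Ū^j = V on Λ_j, j = 0, …, k"*, with the constraint imposed on the bond family `bonds j`
(the object whose definition is in dispute). [cite: Balaban1985RegularSpaces, (1.13)] -/
def Constr (bonds : ℕ → Set (ZdEdge d)) (avg : ℕ → LGConfig d G → LGConfig d G)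
    (V : ℕ → ZdEdge d → G) : Set (LGConfig d G) :=
  {U | ∀ j c, c ∈ bonds j → avg j U c = V j c}

/-- The restricted gauge transformations (1.14), p. 78 [PDF 4]: *"u(y) = 1 for y ∈ 𝔅_k"*.
[cite: Balaban1985RegularSpaces, (1.14)] -/
def ResGauge [One G] (B : Set (Fin d → ℤ)) : Set ((Fin d → ℤ) → G) := {g | ∀ x ∈ B, g x = 1}

/-- "`S` is invariant with respect to the gauge transformations in `Γ`". [folklore] -/
def Invariant [Group G] (S : Set (LGConfig d G)) (Γ : Set ((Fin d → ℤ) → G)) : Prop :=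
  ∀ g ∈ Γ, ∀ U ∈ S, gaugeTransformZd g U ∈ S

/-- The hypothesis `CovLaw` HOLDS for the tree's axial block holonomy `Ū^j := axialBlockHolonomy (L^j)`
(parallel transport along the straight line between block corners), by
`axialBlockHolonomy_gaugeTransformZd` (Bałaban CMP 95 (1984) (1.7); telescoping). [folklore] -/
theorem covLaw_axialBlockHolonomy [Group G] (L : ℕ) :
    CovLaw (d := d) (G := G) L fun j => axialBlockHolonomy (L ^ j) := by
  intro j g U c
  show axialBlockHolonomy (L ^ j) (gaugeTransformZd g U) c =
    g (src L j c) * axialBlockHolonomy (L ^ j) U c * (g (tgt L j c))⁻¹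
  rw [axialBlockHolonomy_gaugeTransformZd, tgt_eq_blockBase]
  rfl

/-- p. 78's invariance sentence, in the form that IS a one-line consequence of the covariance law: if every
constraint bond has BOTH endpoints in the set `B` on which `u = 1`, then (1.13) is invariant under (1.14).
[folklore] -/
theorem invariant_of_endpoints_mem [Group G] {L : ℕ} {avg : ℕ → LGConfig d G → LGConfig d G}
    (hcov : CovLaw L avg) {bonds : ℕ → Set (ZdEdge d)} {B : Set (Fin d → ℤ)}
    (hB : ∀ j c, c ∈ bonds j → src L j c ∈ B ∧ tgt L j c ∈ B) (V : ℕ → ZdEdge d → G) :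
    Invariant (Constr bonds avg V) (ResGauge B) := by
  intro g hg U hU j c hc
  obtain ⟨hs, ht⟩ := hB j c hc
  rw [hcov, hg _ hs, hg _ ht, hU j c hc, one_mul, inv_one, mul_one]

/-- The mechanism of `G-adv8-10 (a)`: under the covariance law, ONE constraint bond with an endpoint
outside `B` (and two distinct endpoints) and ONE group element `a ≠ 1` move EVERY constrained
configuration out of the constraint set by a gauge transformation `≡ 1` on `B` (namely `u = a` at the
free endpoint, `u = 1` elsewhere). [folklore] -/
theorem exists_resGauge_not_mem [Group G] {L : ℕ} {avg : ℕ → LGConfig d G → LGConfig d G}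
    (hcov : CovLaw L avg) {bonds : ℕ → Set (ZdEdge d)} {B : Set (Fin d → ℤ)} {j : ℕ} {c : ZdEdge d}
    (hc : c ∈ bonds j) (hne : src L j c ≠ tgt L j c) (hout : src L j c ∉ B ∨ tgt L j c ∉ B)
    {a : G} (ha : a ≠ 1) (V : ℕ → ZdEdge d → G) {U : LGConfig d G} (hU : U ∈ Constr bonds avg V) :
    ∃ g ∈ ResGauge B, gaugeTransformZd g U ∉ Constr bonds avg V := by
  rcases hout with hout | hout
  · refine ⟨Function.update 1 (src L j c) a, fun x hx => ?_, fun h => ha ?_⟩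
    · rw [Function.update_of_ne (by rintro rfl; exact hout hx)]; rfl
    · have h1 := h j c hc
      rw [hcov, hU j c hc, Function.update_self, Function.update_of_ne hne.symm, Pi.one_apply,
        inv_one, mul_one] at h1
      exact mul_right_cancel (h1.trans (one_mul _).symm)
  · refine ⟨Function.update 1 (tgt L j c) a, fun x hx => ?_, fun h => ha ?_⟩
    · rw [Function.update_of_ne (by rintro rfl; exact hout hx)]; rfl
    · have h1 := h j c hc
      rw [hcov, hU j c hc, Function.update_self, Function.update_of_ne hne, Pi.one_apply,
        one_mul] at h1
      exact inv_eq_one.mp (mul_left_cancel (h1.trans (mul_one _).symm))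

/-- Repair R_B makes p. 78's sentence true for ANY domain sequence. [folklore] -/
theorem bondsB_invariant [Group G] {L : ℕ} {Ω : ℕ → Set (Fin d → ℤ)}
    {avg : ℕ → LGConfig d G → LGConfig d G} (hcov : CovLaw L avg) (V : ℕ → ZdEdge d → G) :
    Invariant (Constr (bondsB L Ω) avg V) (ResGauge (Bk L Ω)) :=
  invariant_of_endpoints_mem hcov (fun _ _ hc => hc.2) V

end Gauge

/-! ### The geometric setting (1.3)–(1.4), the parts used -/

/-- The hypotheses on the domain sequence that the certificate uses, all read off (1.3)–(1.4), p. 77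
[PDF 3] (scaled coordinates; `Ω n = ∅` beyond the last level is allowed and harmless):
* `anti` — (1.3) *"Ω₀ ⊃ Ω₁ ⊃ Ω₂ ⊃ … ⊃ Ω_k"*;
* `sat` — (1.4) *"Ω_j = B^j(Ω_j^{(j)})"*: `Ω_j` is a union of level-`j` blocks, i.e. saturated for
  `blockMap (L^j)`;
* `sep` — the consequence of (1.4) *"(L^jη)^{-1} dist(Ω_j^c, Ω_{j+1}) > RM₁"* with `RM₁ ≥ L` (`ℓ^∞`
  distance; `RM₁ ≥ √d·L` if `dist` is Euclidean; *"R is a sufficiently large positive integer (a power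
  of L)"*, *"M₁ … is much bigger than δ₀^{-1}"*): the `ℓ^∞`-ball of radius `L^{n+1}η` about a point of
  `Ω_{n+1}` lies in `Ω_n`.
[cite: Balaban1985RegularSpaces, (1.3)–(1.4)] -/
structure DomainSeq (L : ℕ) (Ω : ℕ → Set (Fin d → ℤ)) : Prop where
  anti : ∀ n, Ω (n + 1) ⊆ Ω n
  sat : ∀ (n : ℕ) (x y : (Fin d → ℤ)), blockMap (L ^ n) x = blockMap (L ^ n) y → x ∈ Ω n → y ∈ Ω n
  sep : ∀ (n : ℕ) (x t : (Fin d → ℤ)), x ∈ Ω (n + 1) → (∀ i, |t i| ≤ (L : ℤ) ^ (n + 1)) → x + t ∈ Ω n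

namespace DomainSeq

variable {L : ℕ} {Ω : ℕ → Set (Fin d → ℤ)}

/-- (1.3) iterated: `Ω_m ⊆ Ω_n` for `n ≤ m`. [folklore] -/
theorem anti_le (h : DomainSeq L Ω) {n m : ℕ} (hnm : n ≤ m) : Ω m ⊆ Ω n :=
  antitone_nat_of_succ_le h.anti hnm

/-- A forward step of level `j ≤ n+1` from `Ω_{n+1}` stays in `Ω_n` (`sep`). [folklore] -/
theorem add_step_mem (h : DomainSeq L Ω) (hL : 1 ≤ L) {j n : ℕ} (hjn : j ≤ n + 1) {x : (Fin d → ℤ)}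
    (hx : x ∈ Ω (n + 1)) (i : Fin d) : x + step L j i ∈ Ω n :=
  h.sep n x _ hx (abs_step_le hL hjn i)

/-- A backward step of level `j ≤ n+1` from `Ω_{n+1}` stays in `Ω_n` (`sep`). [folklore] -/
theorem sub_step_mem (h : DomainSeq L Ω) (hL : 1 ≤ L) {j n : ℕ} (hjn : j ≤ n + 1) {x : (Fin d → ℤ)}
    (hx : x ∈ Ω (n + 1)) (i : Fin d) : x - step L j i ∈ Ω n := by
  rw [sub_eq_add_neg]
  exact h.sep n x _ hx fun i' => by rw [Pi.neg_apply, abs_neg]; exact abs_step_le hL hjn i i'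

/-- Every nonempty `Ω_n` contains a level-`n` point (the corner of one of its blocks). [folklore] -/
theorem exists_isLevel_mem (h : DomainSeq L Ω) (hL : 1 ≤ L) {n : ℕ} (hne : (Ω n).Nonempty) :
    ∃ x, IsLevel L n x ∧ x ∈ Ω n := by
  haveI : NeZero (L ^ n) := ⟨(pow_pos (by omega) _).ne'⟩
  obtain ⟨y, hy⟩ := hne
  exact ⟨_, isLevel_blockBase L n _, h.sat n y _ (blockMap_blockBase _ _).symm hy⟩

end DomainSeq

/-! ### `G-adv8-10 (a)`: the literal reading constrains bonds leaving `𝔅_k`, in every dimension -/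

section Literal

variable {L : ℕ} {Ω : ℕ → Set (Fin d → ℤ)}

/-- A point of `Ω_{j+1}` whose level-`j` neighbour `x + L^j e_i` has left `Ω_{j+1}` is NOT a point of
`𝔅_k`: it lies in `Ω_{n+1}` for `n ≤ j`, and it is not a level-`(j+1)` point (by
`blockMap_add_step_of_isLevel_succ` its neighbour would lie in the same level-`(j+1)` block of the
saturated set `Ω_{j+1}`), so it is in no `Λ_n`. [folklore] -/
theorem not_mem_Bk_of_exit (hΩ : DomainSeq L Ω) (hL : 2 ≤ L) {j : ℕ} {x : (Fin d → ℤ)} {i : Fin d}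
    (hx : x ∈ Ω (j + 1)) (hx' : x + step L j i ∉ Ω (j + 1)) : x ∉ Bk L Ω := by
  rintro ⟨n, hlev, -, hxn1⟩
  rcases Nat.lt_or_ge j n with hn | hn
  · exact hx' (hΩ.sat (j + 1) x _ (blockMap_add_step_of_isLevel_succ hL (hlev.mono hn) i).symm hx)
  · exact hxn1 (hΩ.anti_le (Nat.succ_le_succ hn) hx)

/-- … while that neighbour is a point of `Λ_j` (if `x` is a level-`j` point). [folklore] -/
theorem exit_mem_Lam (hΩ : DomainSeq L Ω) (hL : 1 ≤ L) {j : ℕ} {x : (Fin d → ℤ)} {i : Fin d}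
    (hlev : IsLevel L j x) (hx : x ∈ Ω (j + 1)) (hx' : x + step L j i ∉ Ω (j + 1)) :
    x + step L j i ∈ Lam L Ω j :=
  ⟨hlev.add_step i, hΩ.add_step_mem hL (Nat.le_succ j) hx i, hx'⟩

/-- … so the bond `⟨x, x + L^j e_i⟩` is a bond "of Λ_j" in the p. 77 sense. [folklore] -/
theorem bondAt_mem_literalBonds_of_exit (hΩ : DomainSeq L Ω) (hL : 1 ≤ L) {j : ℕ} {x : (Fin d → ℤ)}
    {i : Fin d} (hlev : IsLevel L j x) (hx : x ∈ Ω (j + 1)) (hx' : x + step L j i ∉ Ω (j + 1)) :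
    bondAt L j x i ∈ literalBonds L Ω j :=
  Or.inr (by rw [tgt_bondAt hlev]; exact exit_mem_Lam hΩ hL hlev hx hx')

/-- Such exit points EXIST as soon as `Ω_{j+1}` is finite and nonempty: a level-`j` point of `Ω_{j+1}`
with maximal `i`-th coordinate. [folklore] -/
theorem exists_exit (hΩ : DomainSeq L Ω) (hL : 1 ≤ L) (j : ℕ) (i : Fin d)
    (hfin : (Ω (j + 1)).Finite) (hne : (Ω (j + 1)).Nonempty) :
    ∃ x, IsLevel L j x ∧ x ∈ Ω (j + 1) ∧ x + step L j i ∉ Ω (j + 1) := by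
  set S : Set (Fin d → ℤ) := {x | IsLevel L j x ∧ x ∈ Ω (j + 1)} with hS
  have hSfin : S.Finite := hfin.subset fun x hx => hx.2
  have hSne : S.Nonempty := by
    obtain ⟨y, hyl, hy⟩ := hΩ.exists_isLevel_mem hL hne
    exact ⟨y, hyl.mono (Nat.le_succ j), hy⟩
  obtain ⟨x, ⟨hxl, hxΩ⟩, hmax⟩ := Set.exists_max_image S (fun x => x i) hSfin hSne
  refine ⟨x, hxl, hxΩ, fun h => ?_⟩
  have h1 := hmax (x + step L j i) ⟨hxl.add_step i, h⟩
  simp only [Pi.add_apply, step_apply_same] at h1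
  have hp : (0 : ℤ) < (L : ℤ) ^ j := pow_pos (by exact_mod_cast hL) j
  linarith

/-- **`G-adv8-10 (a)`, geometric half, every `d ≥ 1`.**  For an admissible domain sequence with `L ≥ 2`
and `Ω_{j+1}` finite nonempty there is a level-`j` bond "of Λ_j" (p. 77 convention) whose source lies in
`Ω_{j+1}` and NOT in `𝔅_k`, its target in `Λ_j`. [folklore] -/
theorem literal_bad_bond (hΩ : DomainSeq L Ω) (hL : 2 ≤ L) (j : ℕ) (i : Fin d)
    (hfin : (Ω (j + 1)).Finite) (hne : (Ω (j + 1)).Nonempty) :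
    ∃ c ∈ literalBonds L Ω j,
      src L j c ∉ Bk L Ω ∧ src L j c ∈ Ω (j + 1) ∧ tgt L j c ∈ Lam L Ω j := by
  have hL1 : 1 ≤ L := le_trans (by norm_num) hL
  obtain ⟨x, hlev, hx, hx'⟩ := exists_exit hΩ hL1 j i hfin hne
  refine ⟨bondAt L j x i, bondAt_mem_literalBonds_of_exit hΩ hL1 hlev hx hx', ?_, ?_, ?_⟩
  · rw [src_bondAt hlev]; exact not_mem_Bk_of_exit hΩ hL hx hx'
  · rw [src_bondAt hlev]; exact hx
  · rw [tgt_bondAt hlev]; exact exit_mem_Lam hΩ hL1 hlev hx hx'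

/-- Such a bond is NOT an R_A bond (its source lies in `Ω_{j+1}`) — the repair removes exactly these.
[folklore] -/
theorem literal_bad_bond_not_mem_bondsA {j : ℕ} {c : ZdEdge d} (hsrc : src L j c ∈ Ω (j + 1)) :
    c ∉ bondsA L Ω j := fun h => h.2.1 hsrc

variable {G : Type*} [Group G]

/-- **`G-adv8-10 (a)`, conclusion.**  Under the covariance law, for an admissible domain sequence with
`L ≥ 2`, `Ω_{j+1}` finite nonempty and a gauge group with an element `a ≠ 1`: EVERY configuration of the
literally-read constraint set (1.13) is moved out of it by some gauge transformation satisfying (1.14).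
[folklore] -/
theorem literal_not_invariant (hΩ : DomainSeq L Ω) (hL : 2 ≤ L) (j : ℕ) (i : Fin d)
    (hfin : (Ω (j + 1)).Finite) (hne : (Ω (j + 1)).Nonempty)
    {avg : ℕ → LGConfig d G → LGConfig d G} (hcov : CovLaw L avg) {a : G} (ha : a ≠ 1)
    (V : ℕ → ZdEdge d → G) {U : LGConfig d G} (hU : U ∈ Constr (literalBonds L Ω) avg V) :
    ∃ g ∈ ResGauge (Bk L Ω), gaugeTransformZd g U ∉ Constr (literalBonds L Ω) avg V := by
  obtain ⟨c, hc, hsrc, -, -⟩ := literal_bad_bond hΩ hL j i hfin hne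
  exact exists_resGauge_not_mem hcov hc (src_ne_tgt (le_trans (by norm_num) hL) j c)
    (Or.inl hsrc) ha V hU

/-- The same as the negation of p. 78's sentence for the literal reading (whenever the constraint set is
nonempty, e.g. for `V` the averages of some configuration). [folklore] -/
theorem literal_not_Invariant (hΩ : DomainSeq L Ω) (hL : 2 ≤ L) (j : ℕ) (i : Fin d)
    (hfin : (Ω (j + 1)).Finite) (hne : (Ω (j + 1)).Nonempty)
    {avg : ℕ → LGConfig d G → LGConfig d G} (hcov : CovLaw L avg) {a : G} (ha : a ≠ 1)
    (V : ℕ → ZdEdge d → G) (hS : (Constr (literalBonds L Ω) avg V).Nonempty) :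
    ¬ Invariant (Constr (literalBonds L Ω) avg V) (ResGauge (Bk L Ω)) := by
  obtain ⟨U, hU⟩ := hS
  intro hinv
  obtain ⟨g, hg, hgU⟩ := literal_not_invariant hΩ hL j i hfin hne hcov ha V hU
  exact hgU (hinv g hg U hU)

end Literal

/-! ### The repairs R_A ⊆ R_B -/

section Repairs

variable {L : ℕ} {Ω : ℕ → Set (Fin d → ℤ)}

/-- A level-`j` point `y ∉ Ω_{j+1}` adjacent (by a level-`j` bond) to a point of `Ω_j` lies in `𝔅_k`:
in `Λ_j` if `y ∈ Ω_j`, else (for `j = m + 1`, by `sep`) in `Λ_m`; for `j = 0` the second case needs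
`Ω_0 = T_η`. [folklore] -/
theorem mem_Bk_of_adjacent (hΩ : DomainSeq L Ω) (hL : 1 ≤ L) (h0 : Ω 0 = Set.univ) {j : ℕ}
    {y z : (Fin d → ℤ)} {i : Fin d} (hz : z ∈ Ω j) (hyz : y = z + step L j i ∨ y = z - step L j i)
    (hyl : IsLevel L j y) (hy1 : y ∉ Ω (j + 1)) : y ∈ Bk L Ω := by
  by_cases hyj : y ∈ Ω j
  · exact ⟨j, hyl, hyj, hy1⟩
  · cases j with
    | zero => exact absurd (by rw [h0]; exact Set.mem_univ y) hyj
    | succ m =>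
      refine ⟨m, hyl.mono (Nat.le_succ m), ?_, hyj⟩
      rcases hyz with rfl | rfl
      · exact hΩ.add_step_mem hL le_rfl hz i
      · exact hΩ.sub_step_mem hL le_rfl hz i

/-- For `Ω_0 = T_η`, every R_A bond has both endpoints in `𝔅_k`. [folklore] -/
theorem bondsA_endpoints (hΩ : DomainSeq L Ω) (hL : 1 ≤ L) (h0 : Ω 0 = Set.univ) {j : ℕ}
    {c : ZdEdge d} (hc : c ∈ bondsA L Ω j) : src L j c ∈ Bk L Ω ∧ tgt L j c ∈ Bk L Ω := by
  obtain ⟨hlit, hs1, ht1⟩ := hc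
  rcases hlit with hs | ht
  · exact ⟨⟨j, hs⟩, mem_Bk_of_adjacent hΩ hL h0 hs.2.1 (Or.inl (tgt_eq_src_add L j c))
      (isLevel_tgt L j c) ht1⟩
  · exact ⟨mem_Bk_of_adjacent hΩ hL h0 ht.2.1 (Or.inr (src_eq_tgt_sub L j c))
      (isLevel_src L j c) hs1, ⟨j, ht⟩⟩

/-- R_A ⊆ R_B (for `Ω_0 = T_η`). [folklore] -/
theorem bondsA_subset_bondsB (hΩ : DomainSeq L Ω) (hL : 1 ≤ L) (h0 : Ω 0 = Set.univ) (j : ℕ) :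
    bondsA L Ω j ⊆ bondsB L Ω j := fun _ hc => ⟨hc.1, bondsA_endpoints hΩ hL h0 hc⟩

/-- Repair R_A makes p. 78's sentence true when `Ω_0 = T_η`. [folklore] -/
theorem bondsA_invariant {G : Type*} [Group G] (hΩ : DomainSeq L Ω) (hL : 1 ≤ L)
    (h0 : Ω 0 = Set.univ) {avg : ℕ → LGConfig d G → LGConfig d G} (hcov : CovLaw L avg)
    (V : ℕ → ZdEdge d → G) : Invariant (Constr (bondsA L Ω) avg V) (ResGauge (Bk L Ω)) :=
  invariant_of_endpoints_mem hcov (fun _ _ hc => bondsA_endpoints hΩ hL h0 hc) V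

/-- OUTER boundary of `Ω_0 ≠ T_η`: a level-`0` bond leaving `Ω_0` is an R_A bond whose target is not in
`𝔅_k` (it is in no `Ω_n`). [folklore] -/
theorem outer_bondA (hΩ : DomainSeq L Ω) (hL : 1 ≤ L) {x : (Fin d → ℤ)} {i : Fin d} (hx : x ∈ Ω 0)
    (hx' : x + step L 0 i ∉ Ω 0) :
    bondAt L 0 x i ∈ bondsA L Ω 0 ∧ tgt L 0 (bondAt L 0 x i) ∉ Bk L Ω := by
  have hlev : IsLevel L 0 x := IsLevel.zero L x
  have hx1 : x ∉ Ω 1 := fun h => hx' (hΩ.add_step_mem hL (Nat.zero_le _) h i)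
  have hout : ∀ n, x + step L 0 i ∉ Ω n := fun n h => hx' (hΩ.anti_le (Nat.zero_le n) h)
  rw [bondsA, Set.mem_setOf_eq, literalBonds, Set.mem_setOf_eq, src_bondAt hlev, tgt_bondAt hlev]
  exact ⟨⟨Or.inl ⟨hlev, hx, hx1⟩, hx1, hout 1⟩, fun ⟨n, _, hn, _⟩ => hout n hn⟩

/-- … so for `Ω_0 ≠ T_η` with an exiting bond, R_A does NOT restore the invariance (R_B does,
`bondsB_invariant`). [folklore] -/
theorem bondsA_not_invariant_outer {G : Type*} [Group G] (hΩ : DomainSeq L Ω) (hL : 1 ≤ L)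
    {x : (Fin d → ℤ)} {i : Fin d} (hx : x ∈ Ω 0) (hx' : x + step L 0 i ∉ Ω 0)
    {avg : ℕ → LGConfig d G → LGConfig d G} (hcov : CovLaw L avg) {a : G} (ha : a ≠ 1)
    (V : ℕ → ZdEdge d → G) {U : LGConfig d G} (hU : U ∈ Constr (bondsA L Ω) avg V) :
    ∃ g ∈ ResGauge (Bk L Ω), gaugeTransformZd g U ∉ Constr (bondsA L Ω) avg V := by
  obtain ⟨hc, ht⟩ := outer_bondA hΩ hL hx hx'
  exact exists_resGauge_not_mem hcov hc (src_ne_tgt hL 0 _) (Or.inr ht) ha V hU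

/-- R_B ∖ R_A: a level-`j` bond from `Λ_j` INTO a level-`(j+1)` point `y` on a lower face of `Ω_{j+1}`
(`y − L^j e_i ∉ Ω_{j+1}`) has both endpoints in `𝔅_k` (`y ∈ Λ_{j+1}` by `sep`) but an endpoint in
`Ω_{j+1}`. [folklore] -/
theorem lowerFace_bond (hΩ : DomainSeq L Ω) (hL : 1 ≤ L) {j : ℕ} {y : (Fin d → ℤ)} {i : Fin d}
    (hyl : IsLevel L (j + 1) y) (hy : y ∈ Ω (j + 1)) (hy' : y - step L j i ∉ Ω (j + 1)) :
    bondAt L j (y - step L j i) i ∈ bondsB L Ω j ∧ bondAt L j (y - step L j i) i ∉ bondsA L Ω j := by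
  have hxl : IsLevel L j (y - step L j i) := (hyl.mono (Nat.le_succ j)).sub_step i
  have hsrc : src L j (bondAt L j (y - step L j i) i) = y - step L j i := src_bondAt hxl i
  have htgt : tgt L j (bondAt L j (y - step L j i) i) = y := by
    rw [tgt_bondAt hxl, sub_add_cancel]
  have hxLam : y - step L j i ∈ Lam L Ω j := ⟨hxl, hΩ.sub_step_mem hL (Nat.le_succ j) hy i, hy'⟩
  have hyLam : y ∈ Lam L Ω (j + 1) :=
    ⟨hyl, hy, fun h2 => hy' (hΩ.sub_step_mem hL (by omega) h2 i)⟩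
  refine ⟨⟨?_, ?_, ?_⟩, fun h => ?_⟩
  · exact Or.inl (by rw [hsrc]; exact hxLam)
  · rw [hsrc]; exact ⟨j, hxLam⟩
  · rw [htgt]; exact ⟨j + 1, hyLam⟩
  · exact h.2.2 (by rw [htgt]; exact hy)

/-- Lower-face configurations EXIST whenever `Ω_{j+1}` is finite nonempty (a level-`(j+1)` point with
minimal `i`-th coordinate), so R_A ⊊ R_B then. [folklore] -/
theorem exists_lowerFace (hΩ : DomainSeq L Ω) (hL : 1 ≤ L) (j : ℕ) (i : Fin d)
    (hfin : (Ω (j + 1)).Finite) (hne : (Ω (j + 1)).Nonempty) :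
    ∃ y, IsLevel L (j + 1) y ∧ y ∈ Ω (j + 1) ∧ y - step L j i ∉ Ω (j + 1) := by
  haveI : NeZero (L ^ (j + 1)) := ⟨(pow_pos (by omega) _).ne'⟩
  set S : Set (Fin d → ℤ) := {y | IsLevel L (j + 1) y ∧ y ∈ Ω (j + 1)} with hS
  have hSfin : S.Finite := hfin.subset fun x hx => hx.2
  have hSne : S.Nonempty := hΩ.exists_isLevel_mem hL hne
  obtain ⟨y, ⟨hyl, hyΩ⟩, hmin⟩ := Set.exists_min_image S (fun x => x i) hSfin hSne
  refine ⟨y, hyl, hyΩ, fun h => ?_⟩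
  have hz := hmin (blockBase (L ^ (j + 1)) (blockMap (L ^ (j + 1)) (y - step L j i)))
    ⟨isLevel_blockBase L (j + 1) _, hΩ.sat (j + 1) _ _ (blockMap_blockBase _ _).symm h⟩
  have h2 : blockBase (L ^ (j + 1)) (blockMap (L ^ (j + 1)) (y - step L j i)) i ≤
      (y - step L j i) i := by
    simp only [blockBase, blockMap]
    rw [mul_comm]
    exact Int.ediv_mul_le _ (by exact_mod_cast (pow_pos (by omega) (j + 1)).ne')
  have h3 : (y - step L j i) i = y i - (L : ℤ) ^ j := by rw [Pi.sub_apply, step_apply_same]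
  have hp : (0 : ℤ) < (L : ℤ) ^ j := pow_pos (by exact_mod_cast hL) j
  linarith

end Repairs

/-! ### `G-adv8-10 (b)`: boundary bonds between `Λ_{j-1}` and `Λ_j` occur in both orientations -/

section ClassII

variable {L : ℕ} {Ω : ℕ → Set (Fin d → ℤ)}

/-- The PRINTED orientation of (1.31), `b₋ ∈ Λ_{m}`, `b₊ ∈ Λ_{m+1}` (`j = m + 1`), is realised (a
level-`(m+1)` point of `Ω_{m+1}` with minimal `i`-th coordinate and the bond arriving at it).
[folklore] -/
theorem exists_classII_printed (hΩ : DomainSeq L Ω) (hL : 1 ≤ L) (m : ℕ) (i : Fin d)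
    (hfin : (Ω (m + 1)).Finite) (hne : (Ω (m + 1)).Nonempty) :
    ∃ c ∈ literalBonds L Ω (m + 1),
      src L (m + 1) c ∈ Lam L Ω m ∧ tgt L (m + 1) c ∈ Lam L Ω (m + 1) := by
  set S : Set (Fin d → ℤ) := {x | IsLevel L (m + 1) x ∧ x ∈ Ω (m + 1)} with hS
  have hSfin : S.Finite := hfin.subset fun x hx => hx.2
  have hSne : S.Nonempty := hΩ.exists_isLevel_mem hL hne
  obtain ⟨x, ⟨hxl, hxΩ⟩, hmin⟩ := Set.exists_min_image S (fun x => x i) hSfin hSne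
  have hx' : x - step L (m + 1) i ∉ Ω (m + 1) := fun h => by
    have h1 := hmin _ ⟨hxl.sub_step i, h⟩
    simp only [Pi.sub_apply, step_apply_same] at h1
    have hp : (0 : ℤ) < (L : ℤ) ^ (m + 1) := pow_pos (by exact_mod_cast hL) _
    linarith
  have hx2 : x ∉ Ω (m + 2) := fun h2 => hx' (hΩ.sub_step_mem hL (Nat.le_succ (m + 1)) h2 i)
  have hl' : IsLevel L (m + 1) (x - step L (m + 1) i) := hxl.sub_step i
  refine ⟨bondAt L (m + 1) (x - step L (m + 1) i) i, ?_, ?_, ?_⟩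
  · exact Or.inr (by rw [tgt_bondAt hl', sub_add_cancel]; exact ⟨hxl, hxΩ, hx2⟩)
  · rw [src_bondAt hl']
    exact ⟨hl'.mono (Nat.le_succ m), hΩ.sub_step_mem hL le_rfl hxΩ i, hx'⟩
  · rw [tgt_bondAt hl', sub_add_cancel]; exact ⟨hxl, hxΩ, hx2⟩

/-- The MIRRORED orientation, `b₋ ∈ Λ_{m+1}`, `b₊ ∈ Λ_m`, not covered by the displayed formula (1.31),
is realised too (maximal `i`-th coordinate and the bond leaving it). [folklore] -/
theorem exists_classII_mirrored (hΩ : DomainSeq L Ω) (hL : 1 ≤ L) (m : ℕ) (i : Fin d)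
    (hfin : (Ω (m + 1)).Finite) (hne : (Ω (m + 1)).Nonempty) :
    ∃ c ∈ literalBonds L Ω (m + 1),
      src L (m + 1) c ∈ Lam L Ω (m + 1) ∧ tgt L (m + 1) c ∈ Lam L Ω m := by
  set S : Set (Fin d → ℤ) := {x | IsLevel L (m + 1) x ∧ x ∈ Ω (m + 1)} with hS
  have hSfin : S.Finite := hfin.subset fun x hx => hx.2
  have hSne : S.Nonempty := hΩ.exists_isLevel_mem hL hne
  obtain ⟨x, ⟨hxl, hxΩ⟩, hmax⟩ := Set.exists_max_image S (fun x => x i) hSfin hSne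
  have hx' : x + step L (m + 1) i ∉ Ω (m + 1) := fun h => by
    have h1 := hmax _ ⟨hxl.add_step i, h⟩
    simp only [Pi.add_apply, step_apply_same] at h1
    have hp : (0 : ℤ) < (L : ℤ) ^ (m + 1) := pow_pos (by exact_mod_cast hL) _
    linarith
  have hx2 : x ∉ Ω (m + 2) := fun h2 => hx' (hΩ.add_step_mem hL (Nat.le_succ (m + 1)) h2 i)
  refine ⟨bondAt L (m + 1) x i, ?_, ?_, ?_⟩
  · exact Or.inl (by rw [src_bondAt hxl]; exact ⟨hxl, hxΩ, hx2⟩)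
  · rw [src_bondAt hxl]; exact ⟨hxl, hxΩ, hx2⟩
  · rw [tgt_bondAt hxl]
    exact ⟨(hxl.add_step i).mono (Nat.le_succ m), hΩ.add_step_mem hL le_rfl hxΩ i, hx'⟩

end ClassII

/-! ### A fully concrete instance: `Ω_0 = ℤ^d`, `Ω_1 = [0, Lm)^d`, `Ω_n = ∅` for `n ≥ 2` -/

section Concrete

/-- The two-level domain sequence `Ω_0 = T_η` (all of `ℤ^d`), `Ω_1 =` the cube `[0, Lmη)^d` (a union of
`m^d` level-`1` blocks), no further levels. [folklore] -/
def cubeSeq (d L m : ℕ) : ℕ → Set (Fin d → ℤ)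
  | 0 => Set.univ
  | 1 => {x | ∀ i, 0 ≤ x i ∧ x i < (L : ℤ) * m}
  | _ + 2 => ∅

/-- The cube `Ω_1` as a product of intervals. [folklore] -/
theorem cubeSeq_one_eq_pi (d L m : ℕ) :
    cubeSeq d L m 1 = Set.univ.pi fun _ : Fin d => Set.Ico (0 : ℤ) ((L : ℤ) * m) := by
  ext x; simp [cubeSeq, Set.mem_pi]

/-- The cube `Ω_1` is finite. [folklore] -/
theorem cubeSeq_one_finite (d L m : ℕ) : (cubeSeq d L m 1).Finite := by
  rw [cubeSeq_one_eq_pi]; exact Set.Finite.pi fun _ => Set.finite_Ico _ _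

/-- The cube `Ω_1` contains the origin (`L, m ≥ 1`). [folklore] -/
theorem cubeSeq_one_nonempty (d : ℕ) {L m : ℕ} (hL : 1 ≤ L) (hm : 1 ≤ m) :
    (cubeSeq d L m 1).Nonempty :=
  ⟨0, fun _ => ⟨le_rfl, by simpa using (by exact_mod_cast Nat.mul_pos hL hm : (0 : ℤ) < (L : ℤ) * m)⟩⟩

/-- `cubeSeq` is an admissible domain sequence in the sense of `DomainSeq` (for `L ≥ 1`). [folklore] -/
theorem cubeSeq_domainSeq (d : ℕ) {L : ℕ} (hL : 1 ≤ L) (m : ℕ) : DomainSeq L (cubeSeq d L m) where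
  anti n := by
    rcases n with _ | _ | n
    · exact Set.subset_univ _
    · exact Set.empty_subset _
    · exact Set.empty_subset _
  sat n x y hxy hx := by
    rcases n with _ | _ | n
    · exact Set.mem_univ _
    · have hL0 : (0 : ℤ) < L := by exact_mod_cast hL
      intro i
      obtain ⟨h0, h1⟩ := hx i
      have h : x i / (L : ℤ) = y i / (L : ℤ) := by
        have := congr_fun hxy i; simpa [blockMap] using this
      constructor
      · have : 0 ≤ y i / (L : ℤ) := h ▸ Int.ediv_nonneg h0 hL0.le
        exact (Int.ediv_nonneg_iff_of_pos hL0).mp this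
      · have hx' : x i / (L : ℤ) < m := (Int.ediv_lt_iff_lt_mul hL0).mpr (by rwa [mul_comm] at h1)
        have : y i / (L : ℤ) < m := h ▸ hx'
        have := (Int.ediv_lt_iff_lt_mul hL0).mp this
        rwa [mul_comm] at this
    · exact (Set.notMem_empty _ hx).elim
  sep n x t hx _ := by
    rcases n with _ | n
    · exact Set.mem_univ _
    · exact (Set.notMem_empty _ hx).elim

variable {G : Type*} [Group G]

/-- **The concrete counterexample to p. 78's sentence under the literal reading**: `d ≥ 1`, `L ≥ 2`,
`m ≥ 1`, `Ω_0 = ℤ^d ⊃ Ω_1 = [0, Lm)^d`, any family of averages obeying the covariance law, any gauge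
group element `a ≠ 1`: every constrained configuration is moved out of (1.13)-literal by a gauge
transformation `≡ 1` on `𝔅_1 = Λ_0 ∪ Λ_1`. [folklore] -/
theorem cube_literal_not_invariant {d L m : ℕ} (hL : 2 ≤ L) (hm : 1 ≤ m) (i : Fin d)
    {avg : ℕ → LGConfig d G → LGConfig d G} (hcov : CovLaw L avg) {a : G} (ha : a ≠ 1)
    (V : ℕ → ZdEdge d → G) {U : LGConfig d G}
    (hU : U ∈ Constr (literalBonds L (cubeSeq d L m)) avg V) :
    ∃ g ∈ ResGauge (Bk L (cubeSeq d L m)),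
      gaugeTransformZd g U ∉ Constr (literalBonds L (cubeSeq d L m)) avg V :=
  have hL1 : 1 ≤ L := le_trans (by norm_num) hL
  literal_not_invariant (cubeSeq_domainSeq d hL1 m) hL 0 i (cubeSeq_one_finite d L m)
    (cubeSeq_one_nonempty d hL1 hm) hcov ha V hU

/-- … in particular for the axial block holonomies `Ū^j = axialBlockHolonomy (L^j)` and the constraint
values `V` realised by any configuration `U₀`: the literally-read `𝔅_1(𝔅_1, V)` is nonempty and NOT
invariant under (1.14), for every `d ≥ 1`, `L ≥ 2`, `m ≥ 1` and every group with an element `≠ 1`.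
[folklore] -/
theorem cube_axial_not_Invariant {d L m : ℕ} (hd : 1 ≤ d) (hL : 2 ≤ L) (hm : 1 ≤ m)
    (hG : ∃ a : G, a ≠ 1) (U₀ : LGConfig d G) :
    ¬ Invariant
      (Constr (literalBonds L (cubeSeq d L m)) (fun j => axialBlockHolonomy (L ^ j))
        fun j => axialBlockHolonomy (L ^ j) U₀)
      (ResGauge (Bk L (cubeSeq d L m))) := by
  obtain ⟨a, ha⟩ := hG
  have hL1 : 1 ≤ L := le_trans (by norm_num) hL
  exact literal_not_Invariant (cubeSeq_domainSeq d hL1 m) hL 0 ⟨0, hd⟩ (cubeSeq_one_finite d L m)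
    (cubeSeq_one_nonempty d hL1 hm) (covLaw_axialBlockHolonomy L) ha _ ⟨U₀, fun _ _ _ => rfl⟩

end Concrete

end Literature.MathematicalPhysics.QuantumFieldTheory.Balaban1983to89.B8ConstraintBonds
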